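import Summits.QuantumFields.BalabanUV.Beta.NVertexParities

/-!
# `BalabanUV.Beta.NVertexParitiesW` — row D1 ∕ (C1), PART 13: **THE (S3-2) N PARITY `hWNm` OF THE END WRAPPER IS A THEOREM IN SHAPE — the N-system's SECOND-ORDER
# family `WN R P j μ y ν y′` has NO multiplier–multiplier block, pointwise and periodised on every box**

WHY (located).  The END wrapper `FP/StepRecursionFeedNestedNamedB.d1Tel_JcComp_ctr_named` (p405971 ✓) displays, beside the first-order parities that PART 12 typed,
`hWNm : (perF T (dper T (WN (Roots.ctr Lc) Pn (n+1) μ y ν y′))) (fN a) (fN a′) = 0` for an index map `fN` landing in multiplier fibres.  By F6d-2 ∕ F6d-1a ∕ leaf-10's slotted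
W-tables, `WN R P j = (JNat R P (j+1)).W = WchartOf … 0 = W2SymOfK (AN R j) (Lc^(j+1)) S M T₂ M₂` — an1's swap-symmetrised SECOND-ORDER CARRIER through the N-chart (`SecondOrderResponse`:
`vertex2OfK` over the second field partials `T₂ = cE₂ • wilsonW₂ 3 T + cB • compB …`, the two `mixOfK` over the mixed partials `M₂ = wM2 • compMix …`, and `dM (K2OfK …) … S M` over the
first partials `S = cE • wilsonA 3 + cVH • compV …` (the PURE member) and `M = cM • compH …`).  EVERY one of these tables is multiplier–multiplier-free — lit `wilsonW₂_inr_inr`, the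
anti-twin packing `atw` of the row border table (an2 g46 `SecondOrderSocketIdentification`), F6c's `compMixFF = packFF …`, F6a's `compHessFF = packFF …` (`packFF_inr`), lit `wilsonA`, F3's
`compVhS = packVH …` (PART 12 `compV_inr_inr`) — and a zero fibre pattern passes through `vertexOfK` (an2 `BubbleParity.vertexOfK_apply_eq_zero`), through `vertexOfM` (`cwsum_apply_eq_zero`),
hence through `dM`, `vertex2OfK`, `mixOfK`, `W2OfK`, `W2SymOfK` WHATEVER the column kernels are (§1).  So **`WN R P j μ y ν y′ x z (inr m) (inr m′) = 0`** (§2 `WN_inr_inr`) and, under the two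
period sums, **`perF M (dper M (WN R P j μ y ν y′)) (f a) (f a′) = 0`** for every box `M` and every `f` with `∀ a, ∃ m, (f a).2 = inr m` (§3 **`perF_dper_WN_apply_of_inr_inr`** = `hWNm`'s shape;
instantiation at the wrapper is the road's).

WHAT ([folklore] bookkeeping BY NAME; no `def`, no `def … : Prop`, nothing cited, 0 sorry): §1 `vertexOfM_apply_eq_zero`, `dM_apply_eq_zero`, `vertex2OfK_apply_eq_zero`, `mixOfK_apply_eq_zero`,
`W2OfK_apply_eq_zero`, `W2SymOfK_apply_eq_zero` (generic zero fibre pattern `(a, b)` of all four tables ⟹ of the carrier); §2 at the record: `compB_inr_inr`, `compMix_inr`, `tabsComp_M_apply`,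
`JNat_W_eq_W2SymOfK` (`rfl` unfolding), **`WN_inr_inr`**; §3 `perF_dper_WN_inr_inr`, **`perF_dper_WN_apply_of_inr_inr`**.
WHAT THIS IS NOT: not `hWNt` (the field–multiplier ANTI-symmetry the wrapper displays for `WN`): J-NOTE for the road and the successor — the `dM (K2OfK …) N S M μ y` summand of an1's
`W2OfK` carries the PURE member's border table `cVH • compV`, a `packVH` with SYMMETRIC `fb ∕ bf` twins (`packVH_symm`), while `T₂`'s border part is the ANTI-twin `atw` packing; so the `fb`
block of `WN` is not of one twin parity term by term, and `hWNt` as displayed is NOT typed here (to be read with the road against #21's second-order convention before anyone types it);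
not `hHN₂ ∕ hQN₂`; no other row of the END wrapper discharged; 0 estimates; nothing of Bałaban's asserted, valued or discharged; 0∕4 row-D1 binders (hW, hR, D1Tel, D1Rep); ROOT M‴ p325680 ∕
P5c ∕ D6 untouched; NOT (C1), NOT (L2′), NOT D1, NEVER «G-an2-4 closed», NOT BetaPertH, NOT continuum, NOT Clay.

HONEST DEPENDENCY (page 1, mandatory): continuum YM on T⁴ ⇐ BetaPertH ∧ nine spine estimates (0/9 proved); BetaPertH ⇐ (D1) ∧ (D4) ∧ CAP+tail;
G-an2-4 gates asym, D1 and NE2/3/4.  HONEST FRAMING (cell contract, verbatim): «discharging `BetaPertH` makes Bałaban's UV stability UNCONDITIONAL —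
a real constructive-QFT result; it is NOT the continuum limit and NOT the Clay problem.»  ABSOLUTE RULE (cell charter, verbatim): «No internally-minted
statement may enter as a cited fact. Every hypothesis is either kernel-proved in this package or a verbatim quotation of a PUBLISHED theorem with page
reference. The manuscript(s) under audit are NOT citable for their own disputed steps — they are the thing under adjudication; programme-internal
(2001/route/tribunal) claims are never citable.»  Row D1 ∕ (C1) OWNER an2 (b2b-balaban-beta-an2) gen 61, 2026-08-26.  No existing file touched.
-/

noncomputable section

open scoped BigOperators

namespace Summit.QuantumFields.BalabanUV.Beta.NVertexParitiesW

open Finset Matrix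
open Literature.MathematicalPhysics.QuantumFieldTheory
open Literature.MathematicalPhysics.QuantumFieldTheory.Balaban1983to89
open Literature.MathematicalPhysics.QuantumFieldTheory.Balaban1983to89.Beta
open B6Lemma24Torus (pbox)
open ExpKernelCalculus (MKer)
open AffineAveraging (Site box toSite)
open OneStepResolventKernel (Fib KInv)
open OneStepKernelFamily (vertexOfK)
open SecondOrderResponse (vertexOfM dM K2OfK vertex2OfK mixOfK W2OfK W2SymOfK W2OfK_apply dM_apply)
open StepJetData (wilsonA)
open WilsonBiStencil (wilsonW₂ wilsonW₂_inr_inr)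
open BalabanStepW2 (M2Of)
open Summit.QuantumFields.BalabanUV.Beta.AxialDressingRooted (one_le_of_neZero)
open Summit.QuantumFields.BalabanUV.Beta.SpineRooted (SpureRecOf SpureRecOf_zero_level WrecOf T2RecOf T2RecOf_zero_level WrecOf_eq)
open Summit.QuantumFields.BalabanUV.Beta.ChartStepJets (WchartOf WchartOf_eq)
open Summit.QuantumFields.BalabanUV.Beta.SecondOrderSocketIdentification (atw)
open Summit.QuantumFields.BalabanUV.Beta.CompositeHessianTable (compHessFF packFF_inr)
open Summit.QuantumFields.BalabanUV.Beta.CompositeMixedTable (compMixFF)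
open Summit.QuantumFields.BalabanUV.Beta.CompositeCorrectorDress (compChart)
open Summit.QuantumFields.BalabanUV.Beta.CompositeOneShotJets (compV compH compB compMix tabsComp tabsComp_V tabsComp_H tabsComp_vh₂S tabsComp_mixFF)
open Summit.QuantumFields.BalabanUV.Beta.CompositeOneShotJetData (Roots Pins JNat JNat_W AN AN_eq WN WN_eq)
open Summit.QuantumFields.BalabanUV.Beta.FP.KernelPeriodisationFib (Idx perF perF_apply perZ perZ_apply)
open Summit.QuantumFields.BalabanUV.Beta.FP.KernelPeriodisationFibLoc (dper dper_apply)
open Summit.QuantumFields.BalabanUV.Beta.BubbleParity (vertexOfK_apply_eq_zero cwsum_apply_eq_zero)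
open Summit.QuantumFields.BalabanUV.Beta.NVertexParities (compV_inr_inr compH_inr)

/-! ## §1 A zero fibre pattern passes through an1's second-order carriers, whatever the column kernels -/

section Generic

variable {d N : ℕ} {a b : Fib d}

/-- [folklore] a zero fibre pattern of the multiplier table passes to the multiplier-column vertex (every coarse superposition term vanishes). -/
theorem vertexOfM_apply_eq_zero {K : MKer (d + 1) (Fib d)} {M : Fin (d + 1) → (Fin (d + 1) → ℤ) → MKer (d + 1) (Fib d)}
    (hM : ∀ (ρ : Fin (d + 1)) (w x z : Fin (d + 1) → ℤ), M ρ w x z a b = 0) (μ : Fin (d + 1)) (y x z : Fin (d + 1) → ℤ) :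
    vertexOfM K N M μ y x z a b = 0 := by
  simp only [vertexOfM]
  exact Finset.sum_eq_zero fun ρ _ => cwsum_apply_eq_zero fun w => hM ρ w x z

/-- [folklore] … and to the background derivative `dM` (field rows over `S`, multiplier rows over `M`). -/
theorem dM_apply_eq_zero {K : MKer (d + 1) (Fib d)} {S M : Fin (d + 1) → (Fin (d + 1) → ℤ) → MKer (d + 1) (Fib d)}
    (hS : ∀ (κ : Fin (d + 1)) (u x z : Fin (d + 1) → ℤ), S κ u x z a b = 0) (hM : ∀ (ρ : Fin (d + 1)) (w x z : Fin (d + 1) → ℤ), M ρ w x z a b = 0)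
    (μ : Fin (d + 1)) (y x z : Fin (d + 1) → ℤ) : dM K N S M μ y x z a b = 0 := by
  rw [dM_apply, vertexOfK_apply_eq_zero hS μ y x z, vertexOfM_apply_eq_zero hM μ y x z, add_zero]

/-- [folklore] a zero fibre pattern of the second field partials passes to the bi-vertex. -/
theorem vertex2OfK_apply_eq_zero {K : MKer (d + 1) (Fib d)} {S₂ : Fin (d + 1) → (Fin (d + 1) → ℤ) → Fin (d + 1) → (Fin (d + 1) → ℤ) → MKer (d + 1) (Fib d)}
    (hS₂ : ∀ (κ : Fin (d + 1)) (u : Fin (d + 1) → ℤ) (κ' : Fin (d + 1)) (u' x z : Fin (d + 1) → ℤ), S₂ κ u κ' u' x z a b = 0)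
    (μ : Fin (d + 1)) (y : Fin (d + 1) → ℤ) (ν : Fin (d + 1)) (y' x z : Fin (d + 1) → ℤ) : vertex2OfK K N S₂ μ y ν y' x z a b = 0 :=
  vertexOfK_apply_eq_zero (fun κ u x z => vertexOfK_apply_eq_zero (fun κ' u' x z => hS₂ κ u κ' u' x z) ν y' x z) μ y x z

/-- [folklore] a zero fibre pattern of the mixed partials passes to the mixed bi-vertex. -/
theorem mixOfK_apply_eq_zero {K : MKer (d + 1) (Fib d)} {M₂ : Fin (d + 1) → (Fin (d + 1) → ℤ) → Fin (d + 1) → (Fin (d + 1) → ℤ) → MKer (d + 1) (Fib d)}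
    (hM₂ : ∀ (κ : Fin (d + 1)) (u : Fin (d + 1) → ℤ) (ρ : Fin (d + 1)) (w x z : Fin (d + 1) → ℤ), M₂ κ u ρ w x z a b = 0)
    (μ : Fin (d + 1)) (y : Fin (d + 1) → ℤ) (ν : Fin (d + 1)) (y' x z : Fin (d + 1) → ℤ) : mixOfK K N M₂ μ y ν y' x z a b = 0 :=
  vertexOfK_apply_eq_zero (fun κ u x z => vertexOfM_apply_eq_zero (fun ρ w x z => hM₂ κ u ρ w x z) ν y' x z) μ y x z

/-- [folklore] **a zero fibre pattern common to the four tables passes to an1's second-order carrier `W2OfK`, WHATEVER the column kernel** (its `dM` summand reads the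
derivative of the inverse `K2OfK …` — still a kernel, and the lemma is uniform in the kernel). -/
theorem W2OfK_apply_eq_zero {K : MKer (d + 1) (Fib d)} {S M : Fin (d + 1) → (Fin (d + 1) → ℤ) → MKer (d + 1) (Fib d)}
    {S₂ M₂ : Fin (d + 1) → (Fin (d + 1) → ℤ) → Fin (d + 1) → (Fin (d + 1) → ℤ) → MKer (d + 1) (Fib d)}
    (hS : ∀ (κ : Fin (d + 1)) (u x z : Fin (d + 1) → ℤ), S κ u x z a b = 0) (hM : ∀ (ρ : Fin (d + 1)) (w x z : Fin (d + 1) → ℤ), M ρ w x z a b = 0)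
    (hS₂ : ∀ (κ : Fin (d + 1)) (u : Fin (d + 1) → ℤ) (κ' : Fin (d + 1)) (u' x z : Fin (d + 1) → ℤ), S₂ κ u κ' u' x z a b = 0)
    (hM₂ : ∀ (κ : Fin (d + 1)) (u : Fin (d + 1) → ℤ) (ρ : Fin (d + 1)) (w x z : Fin (d + 1) → ℤ), M₂ κ u ρ w x z a b = 0)
    (μ : Fin (d + 1)) (y : Fin (d + 1) → ℤ) (ν : Fin (d + 1)) (y' x z : Fin (d + 1) → ℤ) : W2OfK K N S M S₂ M₂ μ y ν y' x z a b = 0 := by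
  rw [W2OfK_apply]
  simp only [Pi.add_apply, vertex2OfK_apply_eq_zero hS₂, mixOfK_apply_eq_zero hM₂, dM_apply_eq_zero hS hM, add_zero]

/-- [folklore] … and to the swap-symmetrised carrier `W2SymOfK`. -/
theorem W2SymOfK_apply_eq_zero {K : MKer (d + 1) (Fib d)} {S M : Fin (d + 1) → (Fin (d + 1) → ℤ) → MKer (d + 1) (Fib d)}
    {S₂ M₂ : Fin (d + 1) → (Fin (d + 1) → ℤ) → Fin (d + 1) → (Fin (d + 1) → ℤ) → MKer (d + 1) (Fib d)}
    (hS : ∀ (κ : Fin (d + 1)) (u x z : Fin (d + 1) → ℤ), S κ u x z a b = 0) (hM : ∀ (ρ : Fin (d + 1)) (w x z : Fin (d + 1) → ℤ), M ρ w x z a b = 0)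
    (hS₂ : ∀ (κ : Fin (d + 1)) (u : Fin (d + 1) → ℤ) (κ' : Fin (d + 1)) (u' x z : Fin (d + 1) → ℤ), S₂ κ u κ' u' x z a b = 0)
    (hM₂ : ∀ (κ : Fin (d + 1)) (u : Fin (d + 1) → ℤ) (ρ : Fin (d + 1)) (w x z : Fin (d + 1) → ℤ), M₂ κ u ρ w x z a b = 0)
    (μ : Fin (d + 1)) (y : Fin (d + 1) → ℤ) (ν : Fin (d + 1)) (y' x z : Fin (d + 1) → ℤ) : W2SymOfK K N S M S₂ M₂ μ y ν y' x z a b = 0 := by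
  simp only [W2SymOfK, Pi.smul_apply, Pi.add_apply, smul_eq_mul, W2OfK_apply_eq_zero hS hM hS₂ hM₂, add_zero, mul_zero]

end Generic

/-! ## §2 At the record: every second-order table is multiplier–multiplier-free, hence so is `WN` -/

section Record

variable {d : ℕ}

/-- [folklore] the anti-twin packed composite ROW BORDER table has no multiplier–multiplier block (`atw`, by `rfl`). -/
theorem compB_inr_inr (r : Fin (d + 1) → ℕ) (L n : ℕ) (κ : Fin (d + 1)) (u : Site (d + 1)) (κ' : Fin (d + 1)) (u' x z : Site (d + 1)) (m m' : Fin (d + 1)) :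
    compB r L n κ u κ' u' x z (Sum.inr m) (Sum.inr m') = 0 := rfl

/-- [folklore] the composite MIXED table is field–field only: every multiplier row vanishes (F6c `compMixFF = packFF …`, `packFF_inr`). -/
theorem compMix_inr (r : Fin (d + 1) → ℕ) (L n : ℕ) (κ : Fin (d + 1)) (u : Site (d + 1)) (ρ : Fin (d + 1)) (w x z : Site (d + 1)) (m : Fin (d + 1)) (b : Fib d) :
    compMix r L n κ u ρ w x z (Sum.inr m) b = 0 := by
  simp only [compMix, compMixFF, packFF_inr]

/-- [folklore] the record's multiplier tables are `cM j •` the composite constraint-Hessian table (F6b `tabsOf`, `rfl`). -/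
theorem tabsComp_M_apply {r : Fin (d + 1) → ℕ} {L : ℕ} (n : ℕ) (hL : 1 ≤ L) (hr : r ∈ box (d + 1) L) (cM : ℕ → ℝ) (j : ℕ) (ρ : Fin (d + 1)) (w : Site (d + 1)) :
    (tabsComp n hL hr cM).M j ρ w = cM j • compH r L n ρ w := rfl

variable {Lc : ℕ} [NeZero Lc] (R : Roots Lc) (P : Pins) (j : ℕ)

/-- [folklore] **the N-system's second-order family IS an1's swap-symmetrised carrier through the N-chart over the record's slotted tables** (F6d-2 `WN_eq` ∕ F6d-1b `JNat_W` ∕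
F6d-1a `WchartOf_eq` ∕ leaf-10 `WrecOf_eq`, all `rfl`). -/
theorem WN_eq_W2SymOfK :
    WN R P j = W2SymOfK (compChart R.rc Lc (j + 1) (R.s (j + 1)) (Lc ^ (j + 1))) (Lc ^ (j + 1))
      (SpureRecOf 3 (Lc ^ (j + 1)) (tabsComp (j + 1) (one_le_of_neZero Lc) R.hr (P.cM (j + 1))).V (tabsComp (j + 1) (one_le_of_neZero Lc) R.hr (P.cM (j + 1))).H
        (fun _ => compChart R.rc Lc (j + 1) (R.s (j + 1)) (Lc ^ (j + 1))) (P.cE (j + 1)) (P.cVH (j + 1)) (P.cΛ (j + 1)) 0)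
      ((tabsComp (j + 1) (one_le_of_neZero Lc) R.hr (P.cM (j + 1))).M 0)
      (T2RecOf 3 (Lc ^ (j + 1)) (fun _ => compChart R.rc Lc (j + 1) (R.s (j + 1)) (Lc ^ (j + 1)))
        (SpureRecOf 3 (Lc ^ (j + 1)) (tabsComp (j + 1) (one_le_of_neZero Lc) R.hr (P.cM (j + 1))).V (tabsComp (j + 1) (one_le_of_neZero Lc) R.hr (P.cM (j + 1))).H
          (fun _ => compChart R.rc Lc (j + 1) (R.s (j + 1)) (Lc ^ (j + 1))) (P.cE (j + 1)) (P.cVH (j + 1)) (P.cΛ (j + 1)))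
        (tabsComp (j + 1) (one_le_of_neZero Lc) R.hr (P.cM (j + 1))).M (P.cE₂ (j + 1)) (P.cB (j + 1)) (P.T (j + 1))
        (tabsComp (j + 1) (one_le_of_neZero Lc) R.hr (P.cM (j + 1))).vh₂S (tabsComp (j + 1) (one_le_of_neZero Lc) R.hr (P.cM (j + 1))).mixFF 0)
      (M2Of 3 (Lc ^ (j + 1)) (tabsComp (j + 1) (one_le_of_neZero Lc) R.hr (P.cM (j + 1))).mixFF 0) := by
  rw [WN_eq, JNat_W, WchartOf_eq, WrecOf_eq]

/-- [folklore] **`WN_inr_inr` — THE N-SYSTEM's SECOND-ORDER FAMILY HAS NO MULTIPLIER–MULTIPLIER BLOCK.** -/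
theorem WN_inr_inr (μ : Fin (3 + 1)) (y : Site (3 + 1)) (ν : Fin (3 + 1)) (y' x z : Site (3 + 1)) (m m' : Fin (3 + 1)) :
    WN R P j μ y ν y' x z (Sum.inr m) (Sum.inr m') = 0 := by
  rw [WN_eq_W2SymOfK]
  refine W2SymOfK_apply_eq_zero (fun κ u x z => ?_) (fun ρ w x z => ?_) (fun κ u κ' u' x z => ?_) (fun κ u ρ w x z => ?_) μ y ν y' x z
  · -- the PURE first-order member: Wilson + border, both mm-free
    simp only [SpureRecOf_zero_level, Pi.add_apply, Pi.smul_apply, smul_eq_mul, tabsComp_V, compV_inr_inr, mul_zero, add_zero]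
    show P.cE (j + 1) * wilsonA 3 κ u x z (Sum.inr m) (Sum.inr m') = 0
    exact mul_eq_zero_of_right _ rfl
  · -- the multiplier table `cM • compH`: ff-only
    rw [tabsComp_M_apply, Pi.smul_apply, Pi.smul_apply, Pi.smul_apply, Pi.smul_apply, smul_eq_mul, compH_inr, mul_zero]
  · -- the second field partials at level 0: `cE₂ • wilsonW₂ + cB • compB`
    simp only [T2RecOf_zero_level, Pi.add_apply, Pi.smul_apply, smul_eq_mul, tabsComp_vh₂S, wilsonW₂_inr_inr, compB_inr_inr, mul_zero, add_zero]
  · -- the mixed partials `wM2 • compMix`: ff-only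
    simp only [M2Of, Pi.smul_apply, smul_eq_mul, tabsComp_mixFF, compMix_inr, mul_zero]

end Record

/-! ## §3 Periodised, and the binder shape -/

section Binder

variable {Lc : ℕ} [NeZero Lc] (R : Roots Lc) (P : Pins) (j : ℕ) (M : Fin (3 + 1) → ℕ)

/-- [folklore] **the periodised second-order family has no multiplier–multiplier entries.** -/
theorem perF_dper_WN_inr_inr (μ : Fin (3 + 1)) (y : Site (3 + 1)) (ν : Fin (3 + 1)) (y' : Site (3 + 1)) (p q : ↥(pbox M)) (m m' : Fin (3 + 1)) :
    perF M (dper M (WN R P j μ y ν y')) (p, Sum.inr m) (q, Sum.inr m') = 0 := by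
  simp only [perF_apply, perZ_apply, dper_apply, WN_inr_inr, tsum_zero]

variable {ι : Type*} (f : ι → Idx M (Fib 3)) (hf : ∀ a : ι, ∃ m : Fin (3 + 1), (f a).2 = Sum.inr m)
include hf

/-- [folklore] **`perF_dper_WN_apply_of_inr_inr` — `hWNm`'s SHAPE: on two indices in multiplier fibres the periodised second-order family vanishes.** -/
theorem perF_dper_WN_apply_of_inr_inr (μ : Fin (3 + 1)) (y : Site (3 + 1)) (ν : Fin (3 + 1)) (y' : Site (3 + 1)) (a a' : ι) :
    perF M (dper M (WN R P j μ y ν y')) (f a) (f a') = 0 := by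
  obtain ⟨m, hm⟩ := hf a
  obtain ⟨m', hm'⟩ := hf a'
  have ha : f a = ((f a).1, Sum.inr m) := Prod.ext rfl hm
  have ha' : f a' = ((f a').1, Sum.inr m') := Prod.ext rfl hm'
  rw [ha, ha']
  exact perF_dper_WN_inr_inr R P j M μ y ν y' _ _ m m'

end Binder

end Summit.QuantumFields.BalabanUV.Beta.NVertexParitiesW

end
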